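import Literature.MathematicalPhysics.QuantumLattice.HubbardGridUVRowSum
import Literature.MathematicalPhysics.QuantumLattice.HubbardGridUVGram
import Literature.MathematicalPhysics.QuantumLattice.HubbardGridTadpoleFlow
import Literature.MathematicalPhysics.QuantumLattice.GrassmannDeterminantBounded
import HarnessLib

/-!
# The scale decomposition of the shifted Hubbard covariance on the time grid: the sequence `C_j`, its sum, charge/spin structure,
# tadpoles, Gram constants and row sums

Topic `MathematicalPhysics/QuantumLattice`; cell gate-hubbard-kl, R0-SCOPE-4 W7 (the data fed to
`GrassmannFlowDBRefined.iterEffAction_splitFlow_geometric_refined_of_gramBounded`).  With `S = hubbardGridSub L M β N` the grid substitution,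
the infrared scale `Λ₀`, a ratio `r` and `K` infrared scales `Λ_j = (π/β) r^{K-j}` (`1 ≤ j ≤ K`, bottom-anchored: `Λ_K = π/β`), the
covariances integrated in the order `j = 0, 1, …, K` are

`C_0 = Sᵀ (top + uv_{Λ₀}) S`,   `C_j = Sᵀ C^θ_{(Λ_j, Λ_{j-1}]} S` (`1 ≤ j ≤ K`),   `C_j = 0` (`j > K`)

(`gridScaleCov`; `gridScale 0 = Λ₀`).  Proved here: `Σ_{j ≤ K} C_j = Sᵀ C^θ S` (`sum_gridScaleCov`, from
`hubbardCovFullShifted_eq_decomposition` and `hubbardCovBelowShifted_eq_zero` at `Λ_K = π/β`); every `C_j` is charge-off-diagonal and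
spin-diagonal (`gridScaleCov_apply_of_charge_eq/_of_spin_ne`, `contr_gridScaleCov_…`); the same-point contraction is the scale tadpole
`t_j`, the same at every grid point and spin (`contr_gridScaleCov_samePoint`); the replica-stable Gram bounds `IsGramBoundedR (C j) (κ j)`
with `κ_0 = 2√(1+κ_B²)` (`HubbardUVBlockDetBound` + `HubbardGridUVGram`) and `κ_j² = (βL²)⁻²(Λ′β/π+3)·4L(Λ′L/c_{d₀}+1)·(8/3)βL²/Λ` for the
slices (`HubbardGridSliceGram`), the latter `≤ (256 r²/(3π c_{d₀})) Λ_j`; and the row/column sums (`HubbardGridUVRowSum`,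
`HubbardGridSliceRowSum`).

Everything is proved; `gridScale`, `gridScaleSymbol`, `gridScaleCov`, `gridScaleTadpole` are the only definitions; no named facts.

## Sources

G. Benfatto, A. Giuliani, V. Mastropietro, Ann. Henri Poincaré 7 (2006) 809–898, §2.2 (2.9)–(2.14), §2.8 (2.80)–(2.81)
(`BenfattoGiulianiMastropietro2006`); W. de Siqueira Pedra, M. Salmhofer, Comm. Math. Phys. 282 (2008) 797–818, Thm 2.4 (`PedraSalmhofer2008`).
-/

noncomputable section

namespace Literature.MathematicalPhysics.QuantumLattice

open Literature.Probability.LatticeModels GrassmannAlgebra Finset Complex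
open scoped InnerProductSpace

/-! ### The scales and the covariances -/

/-- **The scales**: `Λ_0 = Λ₀` (the infrared scale of the ultraviolet block) and `Λ_j = (π/β) r^{K-j}` for `j ≥ 1`.
[cite: BenfattoGiulianiMastropietro2006, §2.2 (2.9)] -/
def gridScale (β Λ₀ r : ℝ) (K j : ℕ) : ℝ := if j = 0 then Λ₀ else Real.pi / β * r ^ (K - j)

/-- **The symbol integrated at step `j`**: `w_{Λ₀}·p_θ` (`j = 0`), the slice `(w_{Λ_j} - w_{Λ_{j-1}})·p_θ` (`1 ≤ j ≤ K`), `0` beyond.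
[cite: BenfattoGiulianiMastropietro2006, §2.2 (2.10)-(2.11)] -/
def gridScaleSymbol (L M : ℕ) [NeZero L] (β μ θ Λ₀ r : ℝ) (K j : ℕ) : FreqMomentum L M × Fin 2 → ℂ :=
  if j = 0 then uvShiftedSymbol L M β μ θ Λ₀
  else if j ≤ K then shiftedSliceSymbol L M β μ θ (gridScale β Λ₀ r K j) (gridScale β Λ₀ r K (j - 1))
  else fun _ => 0

/-- **The covariance integrated at step `j`, on the grid legs**: `C_j = Sᵀ · normalCovariance (symbol_j) · S`.
[cite: BenfattoGiulianiMastropietro2006, §2.2 (2.12)-(2.14)] -/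
def gridScaleCov (L M N : ℕ) [NeZero L] (β μ θ Λ₀ r : ℝ) (K j : ℕ) :
    Matrix (GridLeg (GridPoint L N)) (GridLeg (GridPoint L N)) ℂ :=
  (hubbardGridSub L M β N).transpose * normalCovariance L M (gridScaleSymbol L M β μ θ Λ₀ r K j) * hubbardGridSub L M β N

/-- **The tadpole of step `j`**: `t_j = -Σ_k (βL²)⁻² symbol_j(k)`. [cite: BenfattoGiulianiMastropietro2006, §2.3 (2.21)-(2.22)] -/
def gridScaleTadpole (L M : ℕ) [NeZero L] (β μ θ Λ₀ r : ℝ) (K j : ℕ) : ℂ :=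
  -∑ k : FreqMomentum L M, ((1 / (β * (L : ℝ) ^ 2) : ℝ) : ℂ) ^ 2 * gridScaleSymbol L M β μ θ Λ₀ r K j (k, 0)

variable {L M N : ℕ} [NeZero L]

/-- `Λ_0 = Λ₀`. [cite: BenfattoGiulianiMastropietro2006, §2.2 (2.9)] -/
@[simp] theorem gridScale_zero (β Λ₀ r : ℝ) (K : ℕ) : gridScale β Λ₀ r K 0 = Λ₀ := by simp [gridScale]

/-- `Λ_j = (π/β) r^{K-j}` for `j ≠ 0`. [cite: BenfattoGiulianiMastropietro2006, §2.2 (2.9)] -/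
theorem gridScale_of_ne_zero (β Λ₀ r : ℝ) (K : ℕ) {j : ℕ} (hj : j ≠ 0) : gridScale β Λ₀ r K j = Real.pi / β * r ^ (K - j) := by
  simp [gridScale, hj]

/-- `Λ_K = π/β` (`K ≠ 0`). [cite: BenfattoGiulianiMastropietro2006, §2.2 (2.9)] -/
theorem gridScale_last (β Λ₀ r : ℝ) {K : ℕ} (hK : K ≠ 0) : gridScale β Λ₀ r K K = Real.pi / β := by
  rw [gridScale_of_ne_zero β Λ₀ r K hK, Nat.sub_self, pow_zero, mul_one]

/-- The symbols do not depend on the spin label. [cite: BenfattoGiulianiMastropietro2006, §2.2 (2.10)] -/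
theorem gridScaleSymbol_spin (β μ θ Λ₀ r : ℝ) (K j : ℕ) (k : FreqMomentum L M) (σ : Fin 2) :
    gridScaleSymbol L M β μ θ Λ₀ r K j (k, σ) = gridScaleSymbol L M β μ θ Λ₀ r K j (k, 0) := by
  unfold gridScaleSymbol uvShiftedSymbol shiftedSliceSymbol shiftedFreeSymbol
  split_ifs <;> rfl

/-- `C_0 = Sᵀ (top + uv_{Λ₀}) S`. [cite: BenfattoGiulianiMastropietro2006, §2.2 (2.10)] -/
theorem gridScaleCov_zero (β μ θ Λ₀ r : ℝ) (K : ℕ) :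
    gridScaleCov L M N β μ θ Λ₀ r K 0 =
      (hubbardGridSub L M β N).transpose * (hubbardCovTopShifted L M β μ θ + hubbardCovUVShifted L M β μ θ Λ₀) * hubbardGridSub L M β N := by
  rw [gridScaleCov, gridScaleSymbol, if_pos rfl, hubbardCovTopShifted_add_uv_eq_normalCovariance]

/-- `C_j = Sᵀ C^θ_{(Λ_j, Λ_{j-1}]} S` for `1 ≤ j ≤ K`. [cite: BenfattoGiulianiMastropietro2006, §2.2 (2.11)] -/
theorem gridScaleCov_slice (β μ θ Λ₀ r : ℝ) {K j : ℕ} (hj : j ≠ 0) (hjK : j ≤ K) :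
    gridScaleCov L M N β μ θ Λ₀ r K j =
      (hubbardGridSub L M β N).transpose * hubbardCovSliceShifted L M β μ θ (gridScale β Λ₀ r K j) (gridScale β Λ₀ r K (j - 1)) *
        hubbardGridSub L M β N := by
  rw [gridScaleCov, gridScaleSymbol, if_neg hj, if_pos hjK, hubbardCovSliceShifted_eq_normalCovariance]

/-- `C_j = 0` for `j > K`. [cite: BenfattoGiulianiMastropietro2006, §2.2 (2.14)] -/
theorem gridScaleCov_of_lt (β μ θ Λ₀ r : ℝ) {K j : ℕ} (hj : K < j) : gridScaleCov L M N β μ θ Λ₀ r K j = 0 := by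
  rw [gridScaleCov, gridScaleSymbol, if_neg (by omega), if_neg (by omega)]
  have : normalCovariance L M (fun _ : FreqMomentum L M × Fin 2 => (0 : ℂ)) = 0 := by
    ext X Y; rw [normalCovariance_apply]; split_ifs <;> simp
  rw [this, Matrix.mul_zero, Matrix.zero_mul]

/-- **The scales resum to the full covariance**: `Σ_{j ≤ K} C_j = Sᵀ C^θ S` (`0 < β`, `1 ≤ K`: the infrared remainder below
`Λ_K = π/β` vanishes). [cite: BenfattoGiulianiMastropietro2006, §2.2 (2.9)-(2.11)] -/
theorem sum_gridScaleCov {β : ℝ} (hβ : 0 < β) (μ θ Λ₀ r : ℝ) {K : ℕ} (hK : K ≠ 0) :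
    ∑ j ∈ range (K + 1), gridScaleCov L M N β μ θ Λ₀ r K j =
      (hubbardGridSub L M β N).transpose * hubbardCovFullShifted L M β μ θ * hubbardGridSub L M β N := by
  rw [hubbardCovFullShifted_eq_decomposition β μ θ (gridScale β Λ₀ r K) K,
    hubbardCovBelowShifted_eq_zero hβ μ θ (Λ := gridScale β Λ₀ r K K) (by rw [gridScale_last β Λ₀ r hK]; positivity)
      (by rw [gridScale_last β Λ₀ r hK]), add_zero, gridScale_zero, sum_range_succ', gridScaleCov_zero]
  have hslice : ∀ k ∈ range K, gridScaleCov L M N β μ θ Λ₀ r K (k + 1) =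
      (hubbardGridSub L M β N).transpose * hubbardCovSliceShifted L M β μ θ (gridScale β Λ₀ r K (k + 1)) (gridScale β Λ₀ r K k) *
        hubbardGridSub L M β N := by
    intro k hk
    rw [gridScaleCov_slice β μ θ Λ₀ r (Nat.succ_ne_zero k) (by have := mem_range.1 hk; omega)]
    rfl
  rw [sum_congr rfl hslice, ← Matrix.sum_mul, ← Matrix.mul_sum]
  simp only [Matrix.mul_add, Matrix.add_mul]
  abel

/-! ### Charge and spin structure, the tadpole -/

/-- Entries between legs of equal charge vanish. [cite: BenfattoGiulianiMastropietro2006, §2.1 (2.3)] -/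
theorem gridScaleCov_apply_of_charge_eq (β μ θ Λ₀ r : ℝ) (K j : ℕ) {X Y : GridLeg (GridPoint L N)} (h : X.2 = Y.2) :
    gridScaleCov L M N β μ θ Λ₀ r K j X Y = 0 :=
  gridSub_pullback_normalCovariance_apply_of_charge_eq β _ _ _ h

/-- Entries between legs of different spin vanish. [cite: BenfattoGiulianiMastropietro2006, §2.1 (2.3)] -/
theorem gridScaleCov_apply_of_spin_ne (β μ θ Λ₀ r : ℝ) (K j : ℕ) {X Y : GridLeg (GridPoint L N)} (h : X.1.2 ≠ Y.1.2) :
    gridScaleCov L M N β μ θ Λ₀ r K j X Y = 0 :=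
  gridSub_pullback_normalCovariance_apply_of_spin_ne β _ _ _ h

/-- Contractions between legs of equal charge vanish. [cite: BenfattoGiulianiMastropietro2006, §2.1 (2.3)] -/
theorem contr_gridScaleCov_of_charge_eq (β μ θ Λ₀ r : ℝ) (K j : ℕ) (X Y : GridLeg (GridPoint L N)) (h : X.2 = Y.2) :
    contr ℂ (gridScaleCov L M N β μ θ Λ₀ r K j) X Y = 0 := by
  rw [contr_apply, gridScaleCov_apply_of_charge_eq β μ θ Λ₀ r K j h, gridScaleCov_apply_of_charge_eq β μ θ Λ₀ r K j h.symm,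
    sub_zero, mul_zero]

/-- Contractions between legs of different spin vanish. [cite: BenfattoGiulianiMastropietro2006, §2.1 (2.3)] -/
theorem contr_gridScaleCov_of_spin_ne (β μ θ Λ₀ r : ℝ) (K j : ℕ) (X Y : GridLeg (GridPoint L N)) (h : X.1.2 ≠ Y.1.2) :
    contr ℂ (gridScaleCov L M N β μ θ Λ₀ r K j) X Y = 0 := by
  rw [contr_apply, gridScaleCov_apply_of_spin_ne β μ θ Λ₀ r K j h, gridScaleCov_apply_of_spin_ne β μ θ Λ₀ r K j (Ne.symm h),
    sub_zero, mul_zero]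

/-- **The same-point contraction is the scale tadpole**, at every grid point and spin. [cite: BenfattoGiulianiMastropietro2006, §2.3 (2.21)-(2.22)] -/
theorem contr_gridScaleCov_samePoint [NeZero N] (β μ θ Λ₀ r : ℝ) (K j : ℕ) (q : GridPoint L N) (σ : Fin 2) :
    contr ℂ (gridScaleCov L M N β μ θ Λ₀ r K j) (((q, σ), 0) : GridLeg (GridPoint L N)) ((q, σ), 1) =
      gridScaleTadpole L M β μ θ Λ₀ r K j := by
  rw [gridScaleCov, hubbardGridSub, contr_gridSub_pullback_samePoint, gridScaleTadpole]
  simp_rw [gridScaleSymbol_spin β μ θ Λ₀ r K j _ σ]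

/-! ### Gram constants -/

section Gram

omit [NeZero L] in
/-- Equal charge flags are equal charges. [folklore] -/
private theorem charge_eq_of_decide_eq {P : Type*} {X Y : GridLeg P} (h : decide (X.2 = 0) = decide (Y.2 = 0)) : X.2 = Y.2 := by
  rcases Fin.exists_fin_two.1 ⟨X.2, rfl⟩ with hX | hX <;> rcases Fin.exists_fin_two.1 ⟨Y.2, rfl⟩ with hY | hY <;>
    simp_all

omit [NeZero L] in
/-- A false charge flag is charge `1`. [folklore] -/
private theorem charge_eq_one_of_decide {P : Type*} {Y : GridLeg P} (h : decide (Y.2 = 0) = false) : Y.2 = 1 := by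
  rcases Fin.exists_fin_two.1 ⟨Y.2, rfl⟩ with hY | hY <;> simp_all


/-- **The Gram constant of the ultraviolet block**: `IsGramBoundedR C_0 (2√(1+κ_B²))`, `κ_B² = 8/(3π) + (1024/(3π c_{d₀}))Λ₀`
(`0 < M`, `|βθ| ≤ π/4`, `μ` at distance `≥ d₀` from `{-4,0}`, `0 < Λ₀ ≤ d₀/2`, `2β√(d₀/8) ≤ L`).
[cite: PedraSalmhofer2008, Thm 2.4] -/
theorem isGramBoundedR_gridScaleCov_zero {β : ℝ} (hβ : 0 < β) (hM : 0 < M) {μ d₀ : ℝ} (hμ4 : d₀ ≤ μ + 4) (hμ0 : d₀ ≤ -μ) {θ : ℝ}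
    (hθ : |β * θ| ≤ Real.pi / 4) {Λ₀ : ℝ} (hΛ₀ : 0 < Λ₀) (hΛ₀d : Λ₀ ≤ d₀ / 2) (hL : 2 * β * Real.sqrt (d₀ / 8) ≤ L) (r : ℝ) (K : ℕ) :
    IsGramBoundedR (gridScaleCov L M N β μ θ Λ₀ r K 0)
      (2 * Real.sqrt (1 + (Real.sqrt (8 / (3 * Real.pi) + 1024 / (3 * Real.pi * (2 * Real.pi * Real.sqrt (d₀ / 8))) * Λ₀)) ^ 2)) := by
  have hθ' : |θ| ≤ Real.pi / (4 * β) := by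
    rw [abs_mul, abs_of_pos hβ] at hθ; rw [le_div_iff₀ (by positivity)]; linarith
  set κB := Real.sqrt (8 / (3 * Real.pi) + 1024 / (3 * Real.pi * (2 * Real.pi * Real.sqrt (d₀ / 8))) * Λ₀) with hκB
  have hd₀ : 0 < d₀ := by linarith
  have hκB2 : κB ^ 2 = 8 / (3 * Real.pi) + 1024 / (3 * Real.pi * (2 * Real.pi * Real.sqrt (d₀ / 8))) * Λ₀ := by
    rw [hκB, Real.sq_sqrt (by positivity)]
  have hF : ∀ X : GridLeg (GridPoint L N), ‖gridGramF L M β (fun p : GridPoint L N => p.2) (fun p => gridTime β N p.1)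
      (fun ks => ((topWeight L M ks.1 - hubbardCutoffWeight L M β μ Λ₀ ks.1 : ℝ) : ℂ) * shiftedFreeSymbol L M β μ θ ks) X‖ ≤ κB := by
    intro X
    refine (pow_le_pow_iff_left₀ (norm_nonneg _) (Real.sqrt_nonneg _) two_ne_zero).1 ?_
    rw [hκB2]; exact norm_sq_gridGramF_topSubCutoff_le hβ hM hμ4 hμ0 hθ' hΛ₀ hΛ₀d hL _ _ X
  have hG : ∀ Y : GridLeg (GridPoint L N), ‖gridGramG L M β (fun p : GridPoint L N => p.2) (fun p => gridTime β N p.1)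
      (fun ks => ((topWeight L M ks.1 - hubbardCutoffWeight L M β μ Λ₀ ks.1 : ℝ) : ℂ) * shiftedFreeSymbol L M β μ θ ks) Y‖ ≤ κB := by
    intro Y
    refine (pow_le_pow_iff_left₀ (norm_nonneg _) (Real.sqrt_nonneg _) two_ne_zero).1 ?_
    rw [hκB2]; exact norm_sq_gridGramG_topSubCutoff_le hβ hM hμ4 hμ0 hθ' hΛ₀ hΛ₀d hL _ _ Y
  rw [gridScaleCov_zero]
  exact (isDetBoundedR_gridSub_hubbardCovTopAddUV hβ μ hθ hM N Λ₀ hF hG).isGramBoundedR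
    (fun X Y h => by
      rw [← gridScaleCov_zero β μ θ Λ₀ r K]
      exact gridScaleCov_apply_of_charge_eq β μ θ Λ₀ r K 0 (charge_eq_of_decide_eq h)) (by positivity)

/-- **The Gram constant of a slice**: for `1 ≤ j ≤ K`, with `Λ = Λ_j ≤ Λ′ = Λ_{j-1} ≤ d₀/2`, `0 < Λ`,
`IsGramBoundedR C_j κ` for every `κ ≥ 0` with `κ² ≥ (βL²)⁻²(Λ′β/π+3)·4L(Λ′L/c_{d₀}+1)·(8/3)βL²/Λ`.
[cite: BenfattoGiulianiMastropietro2006, §2.8 (2.80)] -/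
theorem isGramBoundedR_gridScaleCov_slice {β : ℝ} (hβ : 0 < β) {μ d₀ : ℝ} (hμ4 : d₀ ≤ μ + 4) (hμ0 : d₀ ≤ -μ) {θ : ℝ}
    (hθ : |β * θ| ≤ Real.pi / 4) (Λ₀ r : ℝ) {K j : ℕ} (hj : j ≠ 0) (hjK : j ≤ K)
    (hΛ : 0 < gridScale β Λ₀ r K j) (hΛΛ' : gridScale β Λ₀ r K j ≤ gridScale β Λ₀ r K (j - 1))
    (hΛ'd : gridScale β Λ₀ r K (j - 1) ≤ d₀ / 2) {κ : ℝ} (hκ : 0 ≤ κ)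
    (hκ2 : ‖((1 / (β * (L : ℝ) ^ 2) : ℝ) : ℂ)‖ ^ 2 *
        (((gridScale β Λ₀ r K (j - 1) * β / Real.pi + 3) *
          (4 * (L * (gridScale β Λ₀ r K (j - 1) * L / (2 * Real.pi * Real.sqrt (d₀ / 8)) + 1)))) *
          (8 / 3 * (β * (L : ℝ) ^ 2) / gridScale β Λ₀ r K j)) ≤ κ ^ 2) :
    IsGramBoundedR (gridScaleCov L M N β μ θ Λ₀ r K j) κ := by
  have hθ' : |θ| ≤ Real.pi / (4 * β) := by
    rw [abs_mul, abs_of_pos hβ] at hθ; rw [le_div_iff₀ (by positivity)]; linarith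
  set p := shiftedSliceSymbol L M β μ θ (gridScale β Λ₀ r K j) (gridScale β Λ₀ r K (j - 1)) with hp
  have hcov : gridScaleCov L M N β μ θ Λ₀ r K j =
      (gridSubMatrix L M β (fun q : GridPoint L N => q.2) (fun q => gridTime β N q.1)).transpose * normalCovariance L M p *
        gridSubMatrix L M β (fun q : GridPoint L N => q.2) (fun q => gridTime β N q.1) := by
    rw [gridScaleCov, gridScaleSymbol, if_neg hj, if_pos hjK, hubbardGridSub]
  have hF : ∀ X : GridLeg (GridPoint L N),
      ‖gridGramF L M β (fun q : GridPoint L N => q.2) (fun q => gridTime β N q.1) p X‖ ≤ κ := fun X =>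
    (pow_le_pow_iff_left₀ (norm_nonneg _) hκ two_ne_zero).1
      ((norm_sq_gridGramF_shiftedSlice_le hβ hμ4 hμ0 hθ' hΛ hΛΛ' hΛ'd _ _ X).trans hκ2)
  have hG : ∀ Y : GridLeg (GridPoint L N),
      ‖gridGramG L M β (fun q : GridPoint L N => q.2) (fun q => gridTime β N q.1) p Y‖ ≤ κ := fun Y =>
    (pow_le_pow_iff_left₀ (norm_nonneg _) hκ two_ne_zero).1
      ((norm_sq_gridGramG_shiftedSlice_le hβ hμ4 hμ0 hθ' hΛ hΛΛ' hΛ'd _ _ Y).trans hκ2)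
  rw [hcov]
  exact isGramBoundedR_of_gram (fun X : GridLeg (GridPoint L N) => decide (X.2 = 0)) _
    (fun X Y h => gridSub_pullback_normalCovariance_apply_of_charge_eq β _ _ p (charge_eq_of_decide_eq h))
    (gridGramF L M β (fun q : GridPoint L N => q.2) (fun q => gridTime β N q.1) p)
    (gridGramG L M β (fun q : GridPoint L N => q.2) (fun q => gridTime β N q.1) p) hκ (fun X _ => hF X) (fun Y _ => hG Y)
    (fun X Y hX hY => contr_gridSub_pullback_normalCovariance_eq_inner β _ _ p (by simpa using hX) (charge_eq_one_of_decide hY))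

/-- `C_j = 0` for `j > K` is Gram bounded with any constant `κ ≥ 0`. [cite: BenfattoGiulianiMastropietro2006, §2.8 (2.80)] -/
theorem isGramBoundedR_gridScaleCov_of_lt (β μ θ Λ₀ r : ℝ) {K j : ℕ} (hj : K < j) {κ : ℝ} (hκ : 0 ≤ κ) :
    IsGramBoundedR (gridScaleCov L M N β μ θ Λ₀ r K j) κ := by
  rw [gridScaleCov_of_lt β μ θ Λ₀ r hj]
  refine isGramBoundedR_of_gram (E := EuclideanSpace ℂ (Fin 1)) (fun X : GridLeg (GridPoint L N) => decide (X.2 = 0)) 0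
    (fun _ _ _ => rfl) (fun _ => 0) (fun _ => 0) hκ (fun _ _ => by simpa using hκ) (fun _ _ => by simpa using hκ)
    (fun X Y _ _ => by simp [contr_apply])

end Gram

/-! ### Row sums -/

section RowSums

variable [NeZero N]

/-- **Row and column sums of the ultraviolet block** (`HubbardGridUVRowSum`). [cite: BenfattoGiulianiMastropietro2006, §2.8 (2.81)] -/
theorem exists_rowSum_gridScaleCov_zero {Λ₀ : ℝ} (hΛ₀ : 0 < Λ₀) (hΛ₀1 : Λ₀ ≤ 1) :
    ∃ C : ℝ, 0 < C ∧ ∀ (L M N : ℕ) [NeZero L] [NeZero N] (β μ θ r : ℝ) (K : ℕ),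
      0 < β → |β * θ| ≤ Real.pi / 4 → Real.pi / β ≤ Λ₀ → 2 * (2 * Real.pi / β) ≤ Λ₀ → 2 ≤ M → 2 * M ≤ N → Λ₀ * β ≤ N →
      (Λ₀ * β) ^ 5 ≤ (2 * (M : ℝ) - 3) ^ 2 →
      (∀ X : GridLeg (GridPoint L N), ∑ Y, ‖gridScaleCov L M N β μ θ Λ₀ r K 0 X Y‖ ≤ C * (N / β)) ∧
      (∀ Y : GridLeg (GridPoint L N), ∑ X, ‖gridScaleCov L M N β μ θ Λ₀ r K 0 X Y‖ ≤ C * (N / β)) := by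
  obtain ⟨C, hC, h⟩ := exists_rowSum_uvShifted_le hΛ₀ hΛ₀1
  refine ⟨C, hC, fun L M N _ _ β μ θ r K hβ hθ h1 h2 h3 h4 h5 h6 => ?_⟩
  have := h L M N β μ θ hβ hθ h1 h2 h3 h4 h5 h6
  rw [gridScaleCov_zero]
  exact this

/-- **Row and column sums of the slices** (`HubbardGridSliceRowSum`), `1 ≤ j ≤ K`. [cite: BenfattoGiulianiMastropietro2006, Lemma 2.2 (2.81)] -/
theorem exists_rowSum_gridScaleCov_slice {d₀ r : ℝ} (hd₀ : 0 < d₀) (hr : 1 ≤ r) :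
    ∃ C : ℝ, 0 < C ∧ ∀ (L M N : ℕ) [NeZero L] [NeZero N] (β μ θ Λ₀ : ℝ) (K j : ℕ), j ≠ 0 → j ≤ K →
      0 < β → d₀ ≤ μ + 4 → d₀ ≤ -μ → |β * θ| ≤ Real.pi / 4 → Real.pi / β ≤ gridScale β Λ₀ r K j → gridScale β Λ₀ r K j ≤ 1 →
      gridScale β Λ₀ r K j ≤ gridScale β Λ₀ r K (j - 1) → gridScale β Λ₀ r K (j - 1) ≤ r * gridScale β Λ₀ r K j →
      gridScale β Λ₀ r K (j - 1) ≤ d₀ / 2 → gridScale β Λ₀ r K (j - 1) < Real.pi * (2 * M - 3) / β → 2 * M ≤ N → 2 ≤ M →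
      gridScale β Λ₀ r K j * β ≤ N → 2 * Real.pi * Real.sqrt (d₀ / 8) ≤ gridScale β Λ₀ r K (j - 1) * L →
      (∀ X : GridLeg (GridPoint L N), ∑ Y, ‖gridScaleCov L M N β μ θ Λ₀ r K j X Y‖ ≤
          C * (N / β) / (gridScale β Λ₀ r K j * Real.sqrt (gridScale β Λ₀ r K j))) ∧
      (∀ Y : GridLeg (GridPoint L N), ∑ X, ‖gridScaleCov L M N β μ θ Λ₀ r K j X Y‖ ≤
          C * (N / β) / (gridScale β Λ₀ r K j * Real.sqrt (gridScale β Λ₀ r K j))) := by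
  obtain ⟨C, hC, h⟩ := exists_rowSum_sliceShifted_le hd₀ hr
  refine ⟨C, hC, fun L M N _ _ β μ θ Λ₀ K j hj hjK hβ hμ4 hμ0 hθ h1 h2 h3 h4 h5 h6 h7 h8 h9 h10 => ?_⟩
  have := h L M N β μ θ (gridScale β Λ₀ r K j) (gridScale β Λ₀ r K (j - 1)) hβ hμ4 hμ0 hθ h1 h2 h3 h4 h5 h6 h7 h8 h9 h10
  rw [gridScaleCov_slice β μ θ Λ₀ r hj hjK]
  exact this

end RowSums

end Literature.MathematicalPhysics.QuantumLattice

end
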